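import Mathlib.Data.List.GetD
import Literature.Computability.Complexity.NegationElimination

/-!
# Route ORIncompressibility — frozen NOT gates (helper for `NoNegLimitedCompressionClique`, stmt-PneNP-13976)

Gate-list calculus for FREEZING the NOT gates of a straight-line program over `{∧₂, ∨₂, ¬}`
(Jukna 2012, §10.5; Markov 1958 / Fischer 1975 style arguments): the frozen program of `gs` in a
positional context `η : ℕ → Bool` is

  `gs.mapIdx fun n g => if negWeight g.fn = 1 then constGate ι (η n) else g`

(every NOT gate, at position `n`, becomes the constant gate `η n`); it is a well-formed program
over `{∧₂, ∨₂, 0, 1}` of the same length (`wf_freeze`, `fn_mem_freeze`, `length_freeze`), it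
commutes with prefixes (`freeze_take`), depends on `η` only at the NOT gates (`freeze_congr`),
and its run coincides with the real run when `η` records the actual NOT values
(`vals_freeze_eq`). Ranks of NOT gates (`negs (gs.take n)`) are injective and below the NOT
budget. The DETERMINATION lemma `wireOf_vals_eq_of_freeze`: if two inputs give the same value to
every wire feeding a NOT gate and to the output wire, in the program frozen at the actual NOT
values of the first input, then the real output values agree.

References: S. Jukna, *Boolean Function Complexity* (2012), §10.5; A. A. Markov, J. ACM 5
(1958); M. J. Fischer, *The complexity of negation-limited networks* (1975).
-/

set_option linter.dupNamespace false -- `Summit.PneNP.PneNP.…`: summit = sub-problem name (D-0017 single-conjunct layout)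

namespace Summit.PneNP.PneNP.Theorems

open Literature.Computability.Complexity GateList

section Freeze

variable {ι : Type*}

/-! ### Frozen programs

The frozen program of `gs` in the positional context `η : ℕ → Bool` is
`gs.mapIdx fun n g => if negWeight g.fn = 1 then constGate ι (η n) else g`
(every NOT gate, at position `n`, becomes the constant gate `η n`). -/

/-- Freezing keeps the length. [folklore] -/
theorem length_freeze (η : ℕ → Bool) (gs : List (Gate ι)) :
    (gs.mapIdx fun n g => if negWeight g.fn = 1 then constGate ι (η n) else g).length = gs.length :=
  List.length_mapIdx

/-- Freezing keeps well-formedness (constant gates read nothing). [folklore] -/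
theorem wf_freeze (η : ℕ → Bool) {gs : List (Gate ι)} (hwf : WF gs) :
    WF (gs.mapIdx fun n g => if negWeight g.fn = 1 then constGate ι (η n) else g) := by
  intro j g hj
  rw [List.getElem?_mapIdx] at hj
  cases hgj : gs[j]? with
  | none => rw [hgj] at hj; simp at hj
  | some g₀ =>
    rw [hgj] at hj
    simp only [Option.map_some, Option.some.injEq] at hj
    have hok : GateOK j g₀ := hwf j g₀ hgj
    by_cases h : negWeight g₀.fn = 1
    · rw [if_pos h] at hj
      subst hj
      exact gateOK_constGate j (η j)
    · rw [if_neg h] at hj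
      subst hj
      exact hok

/-- A frozen De Morgan program is a program over `{∧₂, ∨₂, 0, 1}`. [folklore] -/
theorem fn_mem_freeze (η : ℕ → Bool) {gs : List (Gate ι)}
    (hB : ∀ g ∈ gs, g.fn ∈ deMorganBasis) :
    ∀ g ∈ (gs.mapIdx fun n g => if negWeight g.fn = 1 then constGate ι (η n) else g),
      g.fn ∈ monotoneBasis01 := by
  intro g hg
  rw [List.mem_mapIdx] at hg
  obtain ⟨i, hi, rfl⟩ := hg
  by_cases h : negWeight (gs[i]).fn = 1
  · rw [if_pos h, constGate_fn]
    cases η i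
    · exact Set.mem_insert_of_mem _ (Set.mem_insert _ _)
    · exact Set.mem_insert _ _
  · rw [if_neg h]
    have hne : (gs[i]).fn ≠ GateFn.not := fun h' => h ((negWeight_eq_one_iff _).2 h')
    exact mem_monotoneBasis01_of_ne_not
      (deMorganBasis_subset_deMorganBasis01 (hB _ (List.getElem_mem hi))) hne

/-- Freezing commutes with taking a prefix. [folklore] -/
theorem freeze_take (η : ℕ → Bool) (gs : List (Gate ι)) (n : ℕ) :
    (gs.mapIdx fun n g => if negWeight g.fn = 1 then constGate ι (η n) else g).take n =
      (gs.take n).mapIdx fun n g => if negWeight g.fn = 1 then constGate ι (η n) else g := by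
  apply List.ext_getElem
  · simp [List.length_take, List.length_mapIdx]
  · intro i h₁ h₂
    simp [List.getElem_take, List.getElem_mapIdx]

/-- Frozen programs only depend on the context at the NOT gates. [folklore] -/
theorem freeze_congr {η η' : ℕ → Bool} {gs : List (Gate ι)}
    (h : ∀ n (hn : n < gs.length), negWeight (gs[n]).fn = 1 → η n = η' n) :
    (gs.mapIdx fun n g => if negWeight g.fn = 1 then constGate ι (η n) else g) =
      gs.mapIdx fun n g => if negWeight g.fn = 1 then constGate ι (η' n) else g := by
  apply List.ext_getElem
  · simp
  · intro i h₁ h₂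
    simp only [List.getElem_mapIdx]
    have hi : i < gs.length := by simpa using h₁
    by_cases hneg : negWeight (gs[i]).fn = 1
    · rw [if_pos hneg, if_pos hneg, h i hi hneg]
    · rw [if_neg hneg, if_neg hneg]

/-- **The frozen run is the real run when the context is right**: if `η n` is the actual value
of every NOT gate `n` in the run of `gs` on `x`, then the frozen program has the same gate values
on `x`. [folklore] -/
theorem vals_freeze_eq (η : ℕ → Bool) (gs : List (Gate ι)) (x : ι → Bool)
    (hη : ∀ n (hn : n < gs.length), negWeight (gs[n]).fn = 1 → η n = (vals gs x).getD n false) :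
    vals (gs.mapIdx fun n g => if negWeight g.fn = 1 then constGate ι (η n) else g) x = vals gs x := by
  induction gs using List.reverseRecOn with
  | nil => simp
  | append_singleton gs g ih =>
    rw [List.mapIdx_append]
    simp only [List.mapIdx_cons, List.mapIdx_nil, zero_add]
    rw [vals_append_singleton, vals_append_singleton]
    have ih' := ih (fun n hn h1 => ?_)
    · rw [ih']
      congr 1
      by_cases hg : negWeight g.fn = 1
      · rw [if_pos hg]
        have h := hη gs.length (by simp) (by
          rw [List.getElem_concat_length rfl]; exact hg)
        rw [show (gs ++ [g] : List (Gate ι)) = gs ++ g :: [] from rfl, getD_vals_append_cons] at h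
        rw [← h]
        rfl
      · rw [if_neg hg]
    · have h := hη n (by simp; omega) (by rwa [List.getElem_append_left hn])
      rw [h, vals_append_singleton, List.getD_append _ _ _ _ (by simpa using hn)]

/-! ### Reading wires, NOT gates and their ranks -/

/-- A wire pointing below position `n ≤ |gs|` reads only the first `n` gates. [folklore] -/
theorem wireOf_vals_eq_take (gs : List (Gate ι)) (x : ι → Bool) {n : ℕ} (hn : n ≤ gs.length)
    (w : ι ⊕ ℕ) (hw : OutOK n w) :
    wireOf x (vals gs x) w = wireOf x (vals (gs.take n) x) w := by
  conv_lhs => rw [← List.take_append_drop n gs]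
  refine wireOf_vals_append (gs.take n) (gs.drop n) x w fun m hm => ?_
  rw [List.length_take]
  exact lt_min (hw m hm) (lt_of_lt_of_le (hw m hm) hn)

/-- Gate values of a prefix are gate values of the whole program. [folklore] -/
theorem getD_vals_take (gs : List (Gate ι)) (x : ι → Bool) {n i : ℕ} (hi : i < n)
    (hn : n ≤ gs.length) : (vals (gs.take n) x).getD i false = (vals gs x).getD i false := by
  obtain ⟨ws, hws⟩ := vals_append_take (gs.take n) (gs.drop n) x
  rw [List.take_append_drop] at hws
  rw [hws, List.getD_append _ _ _ _ (by simp [List.length_take]; omega)]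

/-- The value of a NOT gate is the negation of the wire it reads (read in the prefix before it).
[folklore] -/
theorem getD_vals_notGate (gs : List (Gate ι)) (x : ι → Bool) {n : ℕ} (hn : n < gs.length)
    {w : ι ⊕ ℕ} (hw : gs[n] = notGate w) :
    (vals gs x).getD n false = !(wireOf x (vals (gs.take n) x) w) := by
  have hsplit : gs = gs.take n ++ notGate w :: gs.drop (n + 1) := by
    rw [← hw, List.getElem_cons_drop hn, List.take_append_drop]
  have hlen : (gs.take n).length = n := by simp [List.length_take]; omega
  have h := getD_vals_append_cons (gs.take n) (notGate w) (gs.drop (n + 1)) x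
  rw [← hsplit, hlen] at h
  rw [h]
  rfl

/-- A NOT gate reads a wire below its own position. [folklore] -/
theorem outOK_of_notGate {gs : List (Gate ι)} (hwf : WF gs) {n : ℕ} (hn : n < gs.length)
    {w : ι ⊕ ℕ} (hw : gs[n] = notGate w) : OutOK n w := by
  intro m hm
  have hok : GateOK n (gs[n]) := hwf n _ (List.getElem?_eq_getElem hn)
  rw [hw] at hok
  exact hok ⟨0, Nat.one_pos⟩ m hm

/-- The rank of a position is at most the total number of NOT gates. [folklore] -/
theorem negs_take_le (gs : List (Gate ι)) (n : ℕ) : negs (gs.take n) ≤ negs gs := by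
  conv_rhs => rw [← List.take_append_drop n gs]
  rw [negs_append]
  exact Nat.le_add_right _ _

/-- Ranks are monotone along the program. [folklore] -/
theorem negs_take_mono (gs : List (Gate ι)) {n n' : ℕ} (h : n ≤ n') :
    negs (gs.take n) ≤ negs (gs.take n') := by
  have := negs_take_le (gs.take n') n
  rwa [List.take_take, min_eq_left h] at this

/-- Past a NOT gate the rank goes up by one. [folklore] -/
theorem negs_take_succ_of_notGate (gs : List (Gate ι)) {n : ℕ} (hn : n < gs.length)
    (hneg : negWeight (gs[n]).fn = 1) : negs (gs.take (n + 1)) = negs (gs.take n) + 1 := by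
  rw [List.take_succ_eq_append_getElem hn, negs_append]
  simp [negs, hneg]

/-- Hence the rank of a NOT gate is below the NOT budget. [folklore] -/
theorem negs_take_lt_of_notGate (gs : List (Gate ι)) {n : ℕ} (hn : n < gs.length)
    (hneg : negWeight (gs[n]).fn = 1) : negs (gs.take n) < negs gs := by
  have h1 := negs_take_succ_of_notGate gs hn hneg
  have h2 := negs_take_le gs (n + 1)
  omega

/-- Distinct NOT gates have distinct ranks. [folklore] -/
theorem eq_of_negs_take_eq (gs : List (Gate ι)) {n n' : ℕ} (hn : n < gs.length)
    (hn' : n' < gs.length) (hneg : negWeight (gs[n]).fn = 1) (hneg' : negWeight (gs[n']).fn = 1)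
    (h : negs (gs.take n) = negs (gs.take n')) : n = n' := by
  by_contra hne
  rcases lt_or_gt_of_ne hne with hlt | hlt
  · have h1 := negs_take_succ_of_notGate gs hn hneg
    have h2 := negs_take_mono gs (show n + 1 ≤ n' by omega)
    omega
  · have h1 := negs_take_succ_of_notGate gs hn' hneg'
    have h2 := negs_take_mono gs (show n' + 1 ≤ n by omega)
    omega

/-- `notGate` is injective in the wire it reads. [folklore] -/
theorem notGate_injective : Function.Injective (notGate (ι := ι)) := by
  intro w w' h
  simp only [notGate, Gate.mk.injEq, heq_eq_eq, true_and] at h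
  first
    | exact h
    | exact congrFun h ⟨0, Nat.one_pos⟩

/-! ### Determination by the frozen family -/

/-- **Determination.** Let `ηₓ` be the actual gate values of the run of `gs` on `x` (as a
positional context). If, in the program frozen in context `ηₓ`, every wire feeding a NOT gate of
`gs`, and the wire `out`, carry the same value on `x` and on `y`, then `out` carries the same
value on `x` and on `y` in the REAL runs of `gs`. (Induction over the NOT gates in program order:
the NOT values of the two runs agree, so both runs are the frozen run.) [folklore] -/
theorem wireOf_vals_eq_of_freeze {gs : List (Gate ι)} (hwf : WF gs) (out : ι ⊕ ℕ)
    (x y : ι → Bool)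
    (H : ∀ n (hn : n < gs.length) (w : ι ⊕ ℕ), gs[n] = notGate w →
      wireOf x (vals (gs.mapIdx fun n g => if negWeight g.fn = 1 then
        constGate ι ((vals gs x).getD n false) else g) x) w =
      wireOf y (vals (gs.mapIdx fun n g => if negWeight g.fn = 1 then
        constGate ι ((vals gs x).getD n false) else g) y) w)
    (Hout : wireOf x (vals (gs.mapIdx fun n g => if negWeight g.fn = 1 then
        constGate ι ((vals gs x).getD n false) else g) x) out =
      wireOf y (vals (gs.mapIdx fun n g => if negWeight g.fn = 1 then
        constGate ι ((vals gs x).getD n false) else g) y) out) :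
    wireOf x (vals gs x) out = wireOf y (vals gs y) out := by
  set ηx : ℕ → Bool := fun n => (vals gs x).getD n false with hηx
  -- Step 1: the NOT gates take the same values in the two runs
  have key : ∀ n (hn : n < gs.length), negWeight (gs[n]).fn = 1 →
      (vals gs x).getD n false = (vals gs y).getD n false := by
    intro n
    induction n using Nat.strong_induction_on with
    | _ n ih =>
      intro hn hneg
      obtain ⟨w, hw⟩ := exists_eq_notGate_of_fn_eq ((negWeight_eq_one_iff _).1 hneg)
      rw [getD_vals_notGate gs x hn hw, getD_vals_notGate gs y hn hw]
      have hwOK : OutOK n w := outOK_of_notGate hwf hn hw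
      -- the frozen runs of the prefix are the real runs
      have hFRx : vals ((gs.take n).mapIdx fun n g => if negWeight g.fn = 1 then
          constGate ι (ηx n) else g) x = vals (gs.take n) x := by
        refine vals_freeze_eq ηx (gs.take n) x fun i hi h1 => ?_
        have hi' : i < n := by simp [List.length_take] at hi; omega
        rw [getD_vals_take gs x hi' hn.le]
      have hFRy : vals ((gs.take n).mapIdx fun n g => if negWeight g.fn = 1 then
          constGate ι (ηx n) else g) y = vals (gs.take n) y := by
        refine vals_freeze_eq ηx (gs.take n) y fun i hi h1 => ?_
        have hi' : i < n := by simp [List.length_take] at hi; omega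
        rw [getD_vals_take gs y hi' hn.le]
        rw [List.getElem_take] at h1
        exact ih i hi' (by omega) h1
      -- the hypothesis at this NOT gate, transported to the prefix
      have h := H n hn w hw
      have hlenF : n ≤ (gs.mapIdx fun n g => if negWeight g.fn = 1 then
          constGate ι (ηx n) else g).length := by rw [length_freeze]; exact hn.le
      rw [wireOf_vals_eq_take _ x hlenF w hwOK, wireOf_vals_eq_take _ y hlenF w hwOK,
        freeze_take, hFRx, hFRy] at h
      rw [h]
  -- Step 2: both full runs are the frozen run in the context `ηx`
  have hFRx : vals (gs.mapIdx fun n g => if negWeight g.fn = 1 then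
      constGate ι (ηx n) else g) x = vals gs x :=
    vals_freeze_eq ηx gs x fun n hn h => rfl
  have hFRy : vals (gs.mapIdx fun n g => if negWeight g.fn = 1 then
      constGate ι (ηx n) else g) y = vals gs y :=
    vals_freeze_eq ηx gs y fun n hn h => key n hn h
  rw [← hFRx, ← hFRy]
  exact Hout

end Freeze

end Summit.PneNP.PneNP.Theorems
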